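import Summits.CriticalPhenomena.PercolationContinuityZ3.Theses.PercTreeValue

/-!
# Route `PercTreeValue`, item `Assembly` (stmt-CriticalPhenomena-7806)

`Assembly` says
`ConnectionPatternFactorisation → TetrahedronHarrisGap → PercolationContinuityZ3`
(`θ_{ℤ³}(p_c) = 0`): pattern-blindness of a jump together with the strict Harris inequality for the
two opposite edges `{0, a_r}`, `{b_r, c_r}` of the regular lattice tetrahedron
`T_r = (0, a_r, b_r, c_r)`, `a_r = (r,r,0)`, `b_r = (r,0,r)`, `c_r = (0,r,r)`, forces continuity of
the percolation probability of `ℤ³` at `p_c`.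

Proof (pure limit bookkeeping; the same argument as the route's deciding theorem `closes`, written
out here so that this file does not depend on the gate-generated proof script): suppose
`θ := θ(p_c) ≠ 0`; `θ` is a probability, so `θ > 0`. All pairwise sup-distances of `T_n` equal `n → ∞`,
so `ConnectionPatternFactorisation` at `p = p_c` gives

* pattern `{(0,1),(2,3)}` on `T_n` (k = 4): `P(0 ↔ a_n ∧ b_n ↔ c_n) → θ⁴`;
* pattern `{(0,1)}` on `(0, a_n)` and on `(b_n, c_n)` (k = 2): `τ(0,a_n) → θ²`, `τ(b_n,c_n) → θ²`.

Passing to the limit (`le_of_tendsto_of_tendsto`) in the strict Harris inequality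
`(1+δ) · τ(0,a_r) · τ(b_r,c_r) ≤ P(0 ↔ a_r ∧ b_r ↔ c_r)` (valid for `r ≥ r₀`) yields
`(1+δ) θ² θ² ≤ θ⁴`, i.e. `δ θ⁴ ≤ 0`, contradicting `δ > 0`, `θ > 0`. Hence `θ(p_c) = 0`, which is
`PercolationContinuityZ3` (`percolationContinuityZ3_iff`).

Sources: Harris 1960 (the non-strict inequality), Grimmett 1999 (θ, p_c, two-point function),
Gladkov 2024 §6.3 (supercritical saturation of k-point amplitudes). Nothing else is used.
-/

namespace Summit.CriticalPhenomena.PercolationContinuityZ3.Theorems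

open MeasureTheory Filter Literature.Probability.Percolation Literature.Probability.LatticeModels
open Summit.CriticalPhenomena.PercolationContinuityZ3.Theses.PercTreeValue

/-- **Item `stmt-CriticalPhenomena-7806` (`PercTreeValue.Assembly`), proved.**
`ConnectionPatternFactorisation → TetrahedronHarrisGap → PercolationContinuityZ3`: in a jump world
(`θ(p_c) > 0`) pattern-blindness sends `P(0 ↔ a_n ∧ b_n ↔ c_n) → θ⁴` and
`τ(0,a_n), τ(b_n,c_n) → θ²` along the regular lattice tetrahedra `T_n`, so the uniform strict Harris
inequality `(1+δ) τ(0,a_r) τ(b_r,c_r) ≤ P(0 ↔ a_r ∧ b_r ↔ c_r)` passes to the limit as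
`(1+δ) θ⁴ ≤ θ⁴`, absurd for `δ > 0 < θ`. Hence `θ(p_c) = 0`. [folklore] -/
theorem percTreeValue_assembly_proof :
    Summit.CriticalPhenomena.PercolationContinuityZ3.Theses.PercTreeValue.Assembly := by
  classical
  unfold Summit.CriticalPhenomena.PercolationContinuityZ3.Theses.PercTreeValue.Assembly
  intro hF hH
  refine Literature.Probability.Percolation.percolationContinuityZ3_iff.mpr ?_
  by_contra hne
  -- θ := θ(p_c) > 0 in the jump world
  have hθnn : 0 ≤ theta (zdGraph 3) (0 : Site 3) (criticalProbI 3) := by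
    unfold Literature.Probability.Percolation.theta
    exact measureReal_nonneg
  have hθpos : 0 < theta (zdGraph 3) (0 : Site 3) (criticalProbI 3) :=
    lt_of_le_of_ne hθnn (Ne.symm hne)
  -- coordinate lower bound ⇒ sup-norm distances tend to ∞
  have key : ∀ (l : Fin 3) (f : ℕ → Site 3),
      (∀ n : ℕ, ‖f n l‖ = (n : ℝ)) → Tendsto (fun n => ‖f n‖) atTop atTop := by
    intro l f hf
    refine tendsto_atTop_mono (fun n => ?_) tendsto_natCast_atTop_atTop
    rw [← hf n]
    exact norm_le_pi_norm (f n) l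
  -- the tetrahedron T_n = (0, a_n, b_n, c_n) and its two opposite edges as 2-point configurations
  let A4 : ℕ → Fin 4 → Site 3 := fun n =>
    ![(0 : Site 3), ![(n : ℤ), (n : ℤ), 0], ![(n : ℤ), 0, (n : ℤ)], ![0, (n : ℤ), (n : ℤ)]]
  let A2 : ℕ → Fin 2 → Site 3 := fun n =>
    ![(0 : Site 3), ![(n : ℤ), (n : ℤ), 0]]
  let B2 : ℕ → Fin 2 → Site 3 := fun n =>
    ![![(n : ℤ), 0, (n : ℤ)], ![0, (n : ℤ), (n : ℤ)]]
  have hdist4 : ∀ i j : Fin 4, i ≠ j →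
      Tendsto (fun n => ‖A4 n i - A4 n j‖) atTop atTop := by
    intro i j hij
    fin_cases i <;> fin_cases j <;> (first | exact absurd rfl hij | skip) <;>
      first
        | (refine key 0 _ (fun n => ?_); simp [A4]; done)
        | (refine key 1 _ (fun n => ?_); simp [A4])
  have hdist2 : ∀ i j : Fin 2, i ≠ j →
      Tendsto (fun n => ‖A2 n i - A2 n j‖) atTop atTop := by
    intro i j hij
    fin_cases i <;> fin_cases j <;> (first | exact absurd rfl hij | skip) <;>
      (refine key 0 _ (fun n => ?_); simp [A2])
  have hdistB : ∀ i j : Fin 2, i ≠ j →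
      Tendsto (fun n => ‖B2 n i - B2 n j‖) atTop atTop := by
    intro i j hij
    fin_cases i <;> fin_cases j <;> (first | exact absurd rfl hij | skip) <;>
      (refine key 0 _ (fun n => ?_); simp [B2])
  -- pattern-blindness limits from ConnectionPatternFactorisation
  have hF' := hF
  unfold ConnectionPatternFactorisation at hF'
  have h4 := hF' (criticalProbI 3) 4 {((0 : Fin 4), (1 : Fin 4)), (2, 3)}
    (by decide) (by decide) A4 hdist4
  have h2a := hF' (criticalProbI 3) 2 {((0 : Fin 2), (1 : Fin 2))}
    (by decide) (by decide) A2 hdist2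
  have h2b := hF' (criticalProbI 3) 2 {((0 : Fin 2), (1 : Fin 2))}
    (by decide) (by decide) B2 hdistB
  have hlim4 : Tendsto (fun r : ℕ =>
      (bondPercolation (zdGraph 3) (criticalProbI 3)).real
        (openConn 0 ![(r : ℤ), (r : ℤ), 0] ∩ openConn ![(r : ℤ), 0, (r : ℤ)] ![0, (r : ℤ), (r : ℤ)]))
      atTop (nhds (theta (zdGraph 3) 0 (criticalProbI 3) ^ 4)) := by
    refine Tendsto.congr (fun r => ?_) h4
    simp [A4]
  have hlim2a : Tendsto (fun r : ℕ => tau 3 (criticalProbI 3) 0 ![(r : ℤ), (r : ℤ), 0])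
      atTop (nhds (theta (zdGraph 3) 0 (criticalProbI 3) ^ 2)) := by
    refine Tendsto.congr (fun r => ?_) h2a
    simp [A2, Literature.Probability.Percolation.tau_def]
  have hlim2b : Tendsto (fun r : ℕ =>
      tau 3 (criticalProbI 3) ![(r : ℤ), 0, (r : ℤ)] ![0, (r : ℤ), (r : ℤ)])
      atTop (nhds (theta (zdGraph 3) 0 (criticalProbI 3) ^ 2)) := by
    refine Tendsto.congr (fun r => ?_) h2b
    simp [B2, Literature.Probability.Percolation.tau_def]
  -- pass to the limit in the strict Harris inequality
  have hH' := hH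
  unfold TetrahedronHarrisGap at hH'
  obtain ⟨δ, hδ, r₀, hr⟩ := hH'
  have hlimL := (hlim2a.const_mul (1 + δ)).mul hlim2b
  have hle := le_of_tendsto_of_tendsto hlimL hlim4 (eventually_atTop.2 ⟨r₀, fun r hr' => hr r hr'⟩)
  have h4pos := pow_pos hθpos 4
  nlinarith [mul_pos hδ h4pos, hle, pow_succ (theta (zdGraph 3) 0 (criticalProbI 3)) 2]

end Summit.CriticalPhenomena.PercolationContinuityZ3.Theorems
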